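import Literature.NumberTheory.Sieve.DrappeauDispersionR1ppReindex
import HarnessLib

/-!
# Drappeau 2017, §5.5: decomposition of `ℛ₁''` into blocked pieces

Topic `Literature/NumberTheory/Sieve`, part of the formalisation of §5 of S. Drappeau, Proc. London
Math. Soc. (3) 114 (2017) 684–732 = arXiv:1504.05549, p. 20–21.  Chaining `R1pp_eq_pieceSum`
(isolating the weight), the smooth dyadic splitting of `γ(q₀·)` (`G0_eq_sum_four`), the double
Möbius inversion of `(q_j, a₁) = 1` (`pieceSum_moebius_two`, the divisors not coprime to
`m = |a₂|n₀` contributing nothing), the flattening and the sign/dyadic block decomposition of the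
rough variable (`pieceSumFlat_eq_sum_blocks`):
`‖ℛ₁''(ξ,λ₁,λ₂)‖ ≤ ∑_{δ₁,δ₂ ∣ a₁, (δ_j,m)=1} ∑_{σ=±1, k<K} ∑_{4 pieces} ‖pieceSumBlk …‖`.
Everything proved (no definition, no named fact).

* `norm_sum_divisors_moebius_le` — `‖∑_{δ₁,δ₂} μμ P‖ ≤ ∑_{(δ_j,m)=1} ‖P‖` when `P = 0` off the
  coprime divisors;
* `norm_R1pp_le_sum_blocks` — the decomposition.

## References

* S. Drappeau, Proc. London Math. Soc. (3) 114 (2017) 684–732, arXiv:1504.05549, §5.5 p. 20–21.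
  [cite: Drappeau2017, §5.5]
-/

noncomputable section

open Finset Real Complex
open scoped ArithmeticFunction.Moebius FourierTransform

namespace Literature.NumberTheory.Sieve

namespace Drappeau2017

open KloostermanQuintilinear

/-- `‖∑_{δ₁,δ₂ ∈ D} μ(δ₁)μ(δ₂) P(δ₁,δ₂)‖ ≤ ∑_{δ₁,δ₂ ∈ D ∩ {p}} ‖P(δ₁,δ₂)‖` when `P` vanishes unless
`p δ₁ ∧ p δ₂`. [folklore] -/
theorem norm_sum_divisors_moebius_le (D : Finset ℕ) (p : ℕ → Prop) [DecidablePred p]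
    (P : ℕ → ℕ → ℂ) (hP : ∀ δ₁ ∈ D, ∀ δ₂ ∈ D, ¬ (p δ₁ ∧ p δ₂) → P δ₁ δ₂ = 0) :
    ‖∑ δ₁ ∈ D, ∑ δ₂ ∈ D, (ArithmeticFunction.moebius δ₁ : ℂ) * (ArithmeticFunction.moebius δ₂ : ℂ) *
        P δ₁ δ₂‖ ≤ ∑ δ₁ ∈ D.filter p, ∑ δ₂ ∈ D.filter p, ‖P δ₁ δ₂‖ := by
  have hμ : ∀ δ : ℕ, ‖(ArithmeticFunction.moebius δ : ℂ)‖ ≤ 1 := by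
    intro δ
    rw [Complex.norm_intCast]
    exact_mod_cast ArithmeticFunction.abs_moebius_le_one
  calc _ ≤ ∑ δ₁ ∈ D, ‖∑ δ₂ ∈ D, (ArithmeticFunction.moebius δ₁ : ℂ) *
          (ArithmeticFunction.moebius δ₂ : ℂ) * P δ₁ δ₂‖ := norm_sum_le _ _
    _ ≤ ∑ δ₁ ∈ D, ∑ δ₂ ∈ D, ‖P δ₁ δ₂‖ := by
        refine Finset.sum_le_sum fun δ₁ _ => (norm_sum_le _ _).trans (Finset.sum_le_sum fun δ₂ _ => ?_)
        rw [norm_mul, norm_mul]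
        calc _ ≤ 1 * 1 * ‖P δ₁ δ₂‖ := by
              apply mul_le_mul (mul_le_mul (hμ δ₁) (hμ δ₂) (norm_nonneg _) zero_le_one) le_rfl
                (norm_nonneg _) (by norm_num)
          _ = ‖P δ₁ δ₂‖ := by ring
    _ = ∑ δ₁ ∈ D.filter p, ∑ δ₂ ∈ D.filter p, ‖P δ₁ δ₂‖ := by
        symm
        rw [Finset.sum_filter]
        refine Finset.sum_congr rfl fun δ₁ hδ₁ => ?_
        rw [Finset.sum_filter]
        split_ifs with h1
        · refine Finset.sum_congr rfl fun δ₂ hδ₂ => ?_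
          split_ifs with h2
          · rfl
          · rw [hP δ₁ hδ₁ δ₂ hδ₂ (fun h => h2 h.2), norm_zero]
        · symm
          refine Finset.sum_eq_zero fun δ₂ hδ₂ => ?_
          rw [hP δ₁ hδ₁ δ₂ hδ₂ (fun h => h1 h.1), norm_zero]

/-- **Decomposition of `ℛ₁''` into blocked pieces.**  For `a₁a₂ ≠ 0`, `(q₀, a₁) = 1`,
`n₀ ∉ (N,2N]` (i.e. `1 ∉ B`), `W = q₀q₁q₂ > H` on the support of `γ ⊗ γ`, and
`|a₁h(n₁−n₂)/q₀| < 2^K` throughout: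
`‖ℛ₁''(ξ,λ₁,λ₂)‖ ≤ ∑_{δ₁,δ₂ ∣ a₁, (δ_j, |a₂|n₀)=1} ∑_{(σ,k)} ∑_{pieces} ‖pieceSumBlk_{piece}(δ₁,δ₂,σ,2^k,2^{k+1})‖`.
[cite: Drappeau2017, §5.5 p. 20–21] -/
theorem norm_R1pp_le_sum_blocks {S Y N M : ℝ} {a₁ a₂ : ℤ} (ha₁ : a₁ ≠ 0) (ha₂ : a₂ ≠ 0)
    {q₀ n₀ : ℕ} (hq₀ : 0 < q₀) (hq₀a₁ : IsCoprime (q₀ : ℤ) a₁) (l₁ l₂ : ℕ) (β : ℕ → ℂ) (ξ : ℝ)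
    (H : ℕ) {K : ℕ}
    (hHW : ∀ q₁ q₂ : ℕ, BFI.bump S Y ((q₀ * q₁ : ℕ) : ℝ) ≠ 0 → BFI.bump S Y ((q₀ * q₂ : ℕ) : ℝ) ≠ 0 →
      H < q₀ * q₁ * q₂)
    (hB : (1 : ℕ) ∉ ((((BFI.dyadic N).filter (fun n : ℕ => IsCoprime (n : ℤ) a₂)).filter (fun n : ℕ => n₀ ∣ n)).image (fun n : ℕ => n / n₀)))
    (hK : ∀ n₁ ∈ ((((BFI.dyadic N).filter (fun n : ℕ => IsCoprime (n : ℤ) a₂)).filter (fun n : ℕ => n₀ ∣ n)).image (fun n : ℕ => n / n₀)), ∀ n₂ ∈ ((((BFI.dyadic N).filter (fun n : ℕ => IsCoprime (n : ℤ) a₂)).filter (fun n : ℕ => n₀ ∣ n)).image (fun n : ℕ => n / n₀)), ∀ h ∈ Finset.Icc (-(H : ℤ)) H,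
      (a₁ * h * (((n₁ : ℤ) - n₂) / q₀)).natAbs < 2 ^ K) :
    ‖∑ q₁ ∈ ((((((BFI.mRange S Y).filter (fun q : ℕ => 0 < q)).filter (fun q : ℕ => IsCoprime (q : ℤ) (a₁ * a₂))).filter (fun q : ℕ => q₀ ∣ q)).image (fun q : ℕ => q / q₀)).filter (fun q : ℕ => q % (a₂.natAbs * n₀) = l₁)),
        ∑ q₂ ∈ ((((((BFI.mRange S Y).filter (fun q : ℕ => 0 < q)).filter (fun q : ℕ => IsCoprime (q : ℤ) (a₁ * a₂))).filter (fun q : ℕ => q₀ ∣ q)).image (fun q : ℕ => q / q₀)).filter (fun q : ℕ => q % (a₂.natAbs * n₀) = l₂)),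
          ((BFI.bump S Y ((q₀ * q₁ : ℕ) : ℝ) : ℝ) : ℂ) * ((BFI.bump S Y ((q₀ * q₂ : ℕ) : ℝ) : ℝ) : ℂ) *
        ∑ n₁ ∈ ((((BFI.dyadic N).filter (fun n : ℕ => IsCoprime (n : ℤ) a₂)).filter (fun n : ℕ => n₀ ∣ n)).image (fun n : ℕ => n / n₀)), ∑ n₂ ∈ ((((BFI.dyadic N).filter (fun n : ℕ => IsCoprime (n : ℤ) a₂)).filter (fun n : ℕ => n₀ ∣ n)).image (fun n : ℕ => n / n₀)),
          (if (Nat.Coprime q₁ q₂ ∧ Nat.Coprime n₁ n₂) then (1 : ℂ) else 0) *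
            (β (n₀ * n₁) * starRingEnd ℂ (β (n₀ * n₂))) *
          (if ((n₀ * n₁).Coprime (q₀ * q₁) ∧ (n₀ * n₂).Coprime (q₀ * q₂) ∧ n₁ ≡ n₂ [MOD q₀]) then
              ∑ h ∈ Finset.Icc (-(H : ℤ)) H,
                (if ((Nat.lcm (q₀ * q₁) (q₀ * q₂) : ℕ) : ℤ) ∣ h then 0 else
                  (𝐞 (-(ξ * h)) : ℂ) * BFI.bumpC 1 (1 / 2) ((Nat.lcm (q₀ * q₁) (q₀ * q₂) : ℕ) * ξ / M) *
                    ((𝐞 ((h : ℝ) * a₁ * ((((n₁ : ℤ) - n₂) / q₀ : ℤ)) *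
                    ((((((q₁ : ℤ) * a₂ * n₀ * n₂ : ℤ) : ZMod (n₁ * q₂))⁻¹).val : ℕ) : ℝ) /
                      ((n₁ : ℝ) * q₂)) : ℂ) *
                      (𝐞 (-((h : ℝ) * a₁ *
                    ((((((q₀ : ℤ) * l₁ * l₂ * n₁ : ℤ) : ZMod (a₂.natAbs * n₀))⁻¹).val : ℕ) : ℝ) /
                      ((a₂ : ℝ) * n₀))) : ℂ)))
            else 0)‖ ≤
      ∑ δ₁ ∈ ((a₁.natAbs.divisors).filter (fun δ : ℕ => Nat.Coprime δ (a₂.natAbs * n₀))),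
        ∑ δ₂ ∈ ((a₁.natAbs.divisors).filter (fun δ : ℕ => Nat.Coprime δ (a₂.natAbs * n₀))),
        ∑ p ∈ ({1, -1} : Finset ℤ) ×ˢ Finset.range K,
          (‖pieceSumBlk a₁ a₂ (((((((BFI.mRange S Y).filter (fun q : ℕ => 0 < q)).filter (fun q : ℕ => IsCoprime (q : ℤ) a₂)).filter (fun q : ℕ => q₀ ∣ q)).image (fun q : ℕ => q / q₀)).filter (fun q : ℕ => q % (a₂.natAbs * n₀) = l₁)).filter (fun q : ℕ => δ₁ ∣ q))
            (((((((BFI.mRange S Y).filter (fun q : ℕ => 0 < q)).filter (fun q : ℕ => IsCoprime (q : ℤ) a₂)).filter (fun q : ℕ => q₀ ∣ q)).image (fun q : ℕ => q / q₀)).filter (fun q : ℕ => q % (a₂.natAbs * n₀) = l₂)).filter (fun q : ℕ => δ₂ ∣ q)) ((((BFI.dyadic N).filter (fun n : ℕ => IsCoprime (n : ℤ) a₂)).filter (fun n : ℕ => n₀ ∣ n)).image (fun n : ℕ => n / n₀))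
            q₀ n₀ l₁ l₂ β ξ (fun q₁ q₂ : ℕ => pieceLo S Y q₀ q₁ * pieceLo S Y q₀ q₂ *
          alphaProfile ((q₀ : ℝ) * ξ / M * q₁ * q₂)) H p.1 (2 ^ p.2) (2 ^ (p.2 + 1))‖ +
          ‖pieceSumBlk a₁ a₂ (((((((BFI.mRange S Y).filter (fun q : ℕ => 0 < q)).filter (fun q : ℕ => IsCoprime (q : ℤ) a₂)).filter (fun q : ℕ => q₀ ∣ q)).image (fun q : ℕ => q / q₀)).filter (fun q : ℕ => q % (a₂.natAbs * n₀) = l₁)).filter (fun q : ℕ => δ₁ ∣ q))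
            (((((((BFI.mRange S Y).filter (fun q : ℕ => 0 < q)).filter (fun q : ℕ => IsCoprime (q : ℤ) a₂)).filter (fun q : ℕ => q₀ ∣ q)).image (fun q : ℕ => q / q₀)).filter (fun q : ℕ => q % (a₂.natAbs * n₀) = l₂)).filter (fun q : ℕ => δ₂ ∣ q)) ((((BFI.dyadic N).filter (fun n : ℕ => IsCoprime (n : ℤ) a₂)).filter (fun n : ℕ => n₀ ∣ n)).image (fun n : ℕ => n / n₀))
            q₀ n₀ l₁ l₂ β ξ (fun q₁ q₂ : ℕ => pieceLo S Y q₀ q₁ * pieceHi S Y q₀ q₂ *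
          alphaProfile ((q₀ : ℝ) * ξ / M * q₁ * q₂)) H p.1 (2 ^ p.2) (2 ^ (p.2 + 1))‖ +
          ‖pieceSumBlk a₁ a₂ (((((((BFI.mRange S Y).filter (fun q : ℕ => 0 < q)).filter (fun q : ℕ => IsCoprime (q : ℤ) a₂)).filter (fun q : ℕ => q₀ ∣ q)).image (fun q : ℕ => q / q₀)).filter (fun q : ℕ => q % (a₂.natAbs * n₀) = l₁)).filter (fun q : ℕ => δ₁ ∣ q))
            (((((((BFI.mRange S Y).filter (fun q : ℕ => 0 < q)).filter (fun q : ℕ => IsCoprime (q : ℤ) a₂)).filter (fun q : ℕ => q₀ ∣ q)).image (fun q : ℕ => q / q₀)).filter (fun q : ℕ => q % (a₂.natAbs * n₀) = l₂)).filter (fun q : ℕ => δ₂ ∣ q)) ((((BFI.dyadic N).filter (fun n : ℕ => IsCoprime (n : ℤ) a₂)).filter (fun n : ℕ => n₀ ∣ n)).image (fun n : ℕ => n / n₀))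
            q₀ n₀ l₁ l₂ β ξ (fun q₁ q₂ : ℕ => pieceHi S Y q₀ q₁ * pieceLo S Y q₀ q₂ *
          alphaProfile ((q₀ : ℝ) * ξ / M * q₁ * q₂)) H p.1 (2 ^ p.2) (2 ^ (p.2 + 1))‖ +
          ‖pieceSumBlk a₁ a₂ (((((((BFI.mRange S Y).filter (fun q : ℕ => 0 < q)).filter (fun q : ℕ => IsCoprime (q : ℤ) a₂)).filter (fun q : ℕ => q₀ ∣ q)).image (fun q : ℕ => q / q₀)).filter (fun q : ℕ => q % (a₂.natAbs * n₀) = l₁)).filter (fun q : ℕ => δ₁ ∣ q))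
            (((((((BFI.mRange S Y).filter (fun q : ℕ => 0 < q)).filter (fun q : ℕ => IsCoprime (q : ℤ) a₂)).filter (fun q : ℕ => q₀ ∣ q)).image (fun q : ℕ => q / q₀)).filter (fun q : ℕ => q % (a₂.natAbs * n₀) = l₂)).filter (fun q : ℕ => δ₂ ∣ q)) ((((BFI.dyadic N).filter (fun n : ℕ => IsCoprime (n : ℤ) a₂)).filter (fun n : ℕ => n₀ ∣ n)).image (fun n : ℕ => n / n₀))
            q₀ n₀ l₁ l₂ β ξ (fun q₁ q₂ : ℕ => pieceHi S Y q₀ q₁ * pieceHi S Y q₀ q₂ *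
          alphaProfile ((q₀ : ℝ) * ξ / M * q₁ * q₂)) H p.1 (2 ^ p.2) (2 ^ (p.2 + 1))‖) := by
  have hA : a₁.natAbs ≠ 0 := Int.natAbs_ne_zero.2 ha₁
  -- Step 1: isolate the weight
  rw [R1pp_eq_pieceSum a₁ a₂ _ _ _ q₀ n₀ l₁ l₂ β ξ S Y M H
    (fun q₁ hq₁ q₂ hq₂ h1 h2 => hHW q₁ q₂ h1 h2)]
  -- Step 2: the moduli sets and the double Möbius inversion
  rw [R1pp_moduliSet_eq S Y q₀ a₂ hq₀a₁,
    filter_filter_comm (((((BFI.mRange S Y).filter (fun q : ℕ => 0 < q)).filter (fun q : ℕ => IsCoprime (q : ℤ) a₂)).filter (fun q : ℕ => q₀ ∣ q)).image (fun q : ℕ => q / q₀)) (fun q : ℕ => Nat.Coprime q a₁.natAbs)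
      (fun q : ℕ => q % (a₂.natAbs * n₀) = l₁),
    filter_filter_comm (((((BFI.mRange S Y).filter (fun q : ℕ => 0 < q)).filter (fun q : ℕ => IsCoprime (q : ℤ) a₂)).filter (fun q : ℕ => q₀ ∣ q)).image (fun q : ℕ => q / q₀)) (fun q : ℕ => Nat.Coprime q a₁.natAbs)
      (fun q : ℕ => q % (a₂.natAbs * n₀) = l₂),
    pieceSum_moebius_two a₁ a₂ _ _ _ q₀ n₀ l₁ l₂ β ξ _ H hA]
  -- Step 3: drop the divisors not coprime to `m`
  refine (norm_sum_divisors_moebius_le _ (fun δ : ℕ => Nat.Coprime δ (a₂.natAbs * n₀)) _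
    (fun δ₁ _ δ₂ _ hδ => pieceSum_eq_zero_of_not_coprime a₁ a₂ _ q₀ n₀ l₁ l₂ β ξ _ H
      (fun q hq => coprime_of_mem_moduliSet S Y a₂ hq) (fun q hq => coprime_of_mem_moduliSet S Y a₂ hq)
      _ _ hδ)).trans ?_
  refine Finset.sum_le_sum fun δ₁ _ => Finset.sum_le_sum fun δ₂ _ => ?_
  -- Step 4: the four pieces
  rw [pieceSum_eq_sum_four a₁ a₂ _ q₀ n₀ l₁ l₂ β ξ
    (G₁₁ := (fun q₁ q₂ : ℕ => pieceLo S Y q₀ q₁ * pieceLo S Y q₀ q₂ *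
          alphaProfile ((q₀ : ℝ) * ξ / M * q₁ * q₂))) (G₁₂ := (fun q₁ q₂ : ℕ => pieceLo S Y q₀ q₁ * pieceHi S Y q₀ q₂ *
          alphaProfile ((q₀ : ℝ) * ξ / M * q₁ * q₂))) (G₂₁ := (fun q₁ q₂ : ℕ => pieceHi S Y q₀ q₁ * pieceLo S Y q₀ q₂ *
          alphaProfile ((q₀ : ℝ) * ξ / M * q₁ * q₂))) (G₂₂ := (fun q₁ q₂ : ℕ => pieceHi S Y q₀ q₁ * pieceHi S Y q₀ q₂ *
          alphaProfile ((q₀ : ℝ) * ξ / M * q₁ * q₂)))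
    (fun q₁ _ q₂ _ => G0_eq_sum_four S Y ξ M q₁ q₂) H]
  -- Step 5: flatten and split into blocks, piece by piece
  have hblk : ∀ G : ℕ → ℕ → ℂ,
      ‖pieceSum a₁ a₂ (((((((BFI.mRange S Y).filter (fun q : ℕ => 0 < q)).filter (fun q : ℕ => IsCoprime (q : ℤ) a₂)).filter (fun q : ℕ => q₀ ∣ q)).image (fun q : ℕ => q / q₀)).filter (fun q : ℕ => q % (a₂.natAbs * n₀) = l₁)).filter (fun q : ℕ => δ₁ ∣ q)) (((((((BFI.mRange S Y).filter (fun q : ℕ => 0 < q)).filter (fun q : ℕ => IsCoprime (q : ℤ) a₂)).filter (fun q : ℕ => q₀ ∣ q)).image (fun q : ℕ => q / q₀)).filter (fun q : ℕ => q % (a₂.natAbs * n₀) = l₂)).filter (fun q : ℕ => δ₂ ∣ q)) ((((BFI.dyadic N).filter (fun n : ℕ => IsCoprime (n : ℤ) a₂)).filter (fun n : ℕ => n₀ ∣ n)).image (fun n : ℕ => n / n₀))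
          q₀ n₀ l₁ l₂ β ξ G H‖ ≤
        ∑ p ∈ ({1, -1} : Finset ℤ) ×ˢ Finset.range K,
          ‖pieceSumBlk a₁ a₂ (((((((BFI.mRange S Y).filter (fun q : ℕ => 0 < q)).filter (fun q : ℕ => IsCoprime (q : ℤ) a₂)).filter (fun q : ℕ => q₀ ∣ q)).image (fun q : ℕ => q / q₀)).filter (fun q : ℕ => q % (a₂.natAbs * n₀) = l₁)).filter (fun q : ℕ => δ₁ ∣ q)) (((((((BFI.mRange S Y).filter (fun q : ℕ => 0 < q)).filter (fun q : ℕ => IsCoprime (q : ℤ) a₂)).filter (fun q : ℕ => q₀ ∣ q)).image (fun q : ℕ => q / q₀)).filter (fun q : ℕ => q % (a₂.natAbs * n₀) = l₂)).filter (fun q : ℕ => δ₂ ∣ q))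
            ((((BFI.dyadic N).filter (fun n : ℕ => IsCoprime (n : ℤ) a₂)).filter (fun n : ℕ => n₀ ∣ n)).image (fun n : ℕ => n / n₀)) q₀ n₀ l₁ l₂ β ξ G H p.1 (2 ^ p.2) (2 ^ (p.2 + 1))‖ := by
    intro G
    rw [pieceSum_eq_flat, pieceSumFlat_eq_sum_blocks a₁ a₂ _ _ _ n₀ l₁ l₂ β ξ G H ha₁ ha₂ hq₀ hB hK]
    exact norm_sum_le _ _
  calc _ ≤ ‖pieceSum a₁ a₂ (((((((BFI.mRange S Y).filter (fun q : ℕ => 0 < q)).filter (fun q : ℕ => IsCoprime (q : ℤ) a₂)).filter (fun q : ℕ => q₀ ∣ q)).image (fun q : ℕ => q / q₀)).filter (fun q : ℕ => q % (a₂.natAbs * n₀) = l₁)).filter (fun q : ℕ => δ₁ ∣ q)) (((((((BFI.mRange S Y).filter (fun q : ℕ => 0 < q)).filter (fun q : ℕ => IsCoprime (q : ℤ) a₂)).filter (fun q : ℕ => q₀ ∣ q)).image (fun q : ℕ => q / q₀)).filter (fun q : ℕ => q % (a₂.natAbs * n₀) = l₂)).filter (fun q : ℕ => δ₂ ∣ q))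 ((((BFI.dyadic N).filter (fun n : ℕ => IsCoprime (n : ℤ) a₂)).filter (fun n : ℕ => n₀ ∣ n)).image (fun n : ℕ => n / n₀))
            q₀ n₀ l₁ l₂ β ξ (fun q₁ q₂ : ℕ => pieceLo S Y q₀ q₁ * pieceLo S Y q₀ q₂ *
          alphaProfile ((q₀ : ℝ) * ξ / M * q₁ * q₂)) H‖ +
          ‖pieceSum a₁ a₂ (((((((BFI.mRange S Y).filter (fun q : ℕ => 0 < q)).filter (fun q : ℕ => IsCoprime (q : ℤ) a₂)).filter (fun q : ℕ => q₀ ∣ q)).image (fun q : ℕ => q / q₀)).filter (fun q : ℕ => q % (a₂.natAbs * n₀) = l₁)).filter (fun q : ℕ => δ₁ ∣ q)) (((((((BFI.mRange S Y).filter (fun q : ℕ => 0 < q)).filter (fun q : ℕ => IsCoprime (q : ℤ) a₂)).filter (fun q : ℕ => q₀ ∣ q)).image (fun q : ℕ => q / q₀)).filter (fun q : ℕ => q % (a₂.natAbs * n₀) = l₂)).filter (fun q : ℕ => δ₂ ∣ q)) ((((BFI.dyadic N).filter (fun n : ℕ => IsCoprime (n : ℤ) a₂)).filter (fun n : ℕ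 => n₀ ∣ n)).image (fun n : ℕ => n / n₀))
            q₀ n₀ l₁ l₂ β ξ (fun q₁ q₂ : ℕ => pieceLo S Y q₀ q₁ * pieceHi S Y q₀ q₂ *
          alphaProfile ((q₀ : ℝ) * ξ / M * q₁ * q₂)) H‖ +
          ‖pieceSum a₁ a₂ (((((((BFI.mRange S Y).filter (fun q : ℕ => 0 < q)).filter (fun q : ℕ => IsCoprime (q : ℤ) a₂)).filter (fun q : ℕ => q₀ ∣ q)).image (fun q : ℕ => q / q₀)).filter (fun q : ℕ => q % (a₂.natAbs * n₀) = l₁)).filter (fun q : ℕ => δ₁ ∣ q)) (((((((BFI.mRange S Y).filter (fun q : ℕ => 0 < q)).filter (fun q : ℕ => IsCoprime (q : ℤ) a₂)).filter (fun q : ℕ => q₀ ∣ q)).image (fun q : ℕ => q / q₀)).filter (fun q : ℕ => q % (a₂.natAbs * n₀) = l₂)).filter (fun q : ℕ => δ₂ ∣ q)) ((((BFI.dyadic N).filter (fun n : ℕ => IsCoprime (n : ℤ) a₂)).filter (fun n : ℕ => n₀ ∣ n)).image (fun n : ℕ => n / n₀))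
            q₀ n₀ l₁ l₂ β ξ (fun q₁ q₂ : ℕ => pieceHi S Y q₀ q₁ * pieceLo S Y q₀ q₂ *
          alphaProfile ((q₀ : ℝ) * ξ / M * q₁ * q₂)) H‖ +
          ‖pieceSum a₁ a₂ (((((((BFI.mRange S Y).filter (fun q : ℕ => 0 < q)).filter (fun q : ℕ => IsCoprime (q : ℤ) a₂)).filter (fun q : ℕ => q₀ ∣ q)).image (fun q : ℕ => q / q₀)).filter (fun q : ℕ => q % (a₂.natAbs * n₀) = l₁)).filter (fun q : ℕ => δ₁ ∣ q)) (((((((BFI.mRange S Y).filter (fun q : ℕ => 0 < q)).filter (fun q : ℕ => IsCoprime (q : ℤ) a₂)).filter (fun q : ℕ => q₀ ∣ q)).image (fun q : ℕ => q / q₀)).filter (fun q : ℕ => q % (a₂.natAbs * n₀) = l₂)).filter (fun q : ℕ => δ₂ ∣ q)) ((((BFI.dyadic N).filter (fun n : ℕ => IsCoprime (n : ℤ) a₂)).filter (fun n : ℕ => n₀ ∣ n)).image (fun n : ℕ => n / n₀))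
            q₀ n₀ l₁ l₂ β ξ (fun q₁ q₂ : ℕ => pieceHi S Y q₀ q₁ * pieceHi S Y q₀ q₂ *
          alphaProfile ((q₀ : ℝ) * ξ / M * q₁ * q₂)) H‖ := by
        refine (norm_add_le _ _).trans (add_le_add ((norm_add_le _ _).trans (add_le_add
          ((norm_add_le _ _).trans (add_le_add le_rfl le_rfl)) le_rfl)) le_rfl)
    _ ≤ _ := by
        rw [Finset.sum_add_distrib, Finset.sum_add_distrib, Finset.sum_add_distrib]
        have h1 := hblk (fun q₁ q₂ : ℕ => pieceLo S Y q₀ q₁ * pieceLo S Y q₀ q₂ *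
          alphaProfile ((q₀ : ℝ) * ξ / M * q₁ * q₂))
        have h2 := hblk (fun q₁ q₂ : ℕ => pieceLo S Y q₀ q₁ * pieceHi S Y q₀ q₂ *
          alphaProfile ((q₀ : ℝ) * ξ / M * q₁ * q₂))
        have h3 := hblk (fun q₁ q₂ : ℕ => pieceHi S Y q₀ q₁ * pieceLo S Y q₀ q₂ *
          alphaProfile ((q₀ : ℝ) * ξ / M * q₁ * q₂))
        have h4 := hblk (fun q₁ q₂ : ℕ => pieceHi S Y q₀ q₁ * pieceHi S Y q₀ q₂ *
          alphaProfile ((q₀ : ℝ) * ξ / M * q₁ * q₂))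
        linarith

end Drappeau2017

end Literature.NumberTheory.Sieve

end
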